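import Literature.NumberTheory.Automorphic.ReciprocityGLn
import Literature.NumberTheory.NumberFields.ArithmeticEquivalenceGassmannProofs
import HarnessLib

/-!
# Stub A of crux `DedekindQuotientEntire` (route `DedekindQuotient1951`): two evaluations

From the polynomial identity `(X - 1)·∏_{a∈α}(X - ι⁻¹(a⁻¹)) = ∏_{𝔭 ∣ q}(X^{f(𝔭|q)} - 1)` over
`ℚ̄_ℓ` (the predicted arithmetic Frobenius polynomial of a Satake parameter `α`, times `X - 1`,
equals the Dedekind polynomial of `K` at `q`), deduce the VALUE identity
`(1 - y)·∏_{a∈α}(1 - a y) = ∏_{f ∈ splittingType K q}(1 - y^f)` for every `y : ℂ`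
(evaluate at `y` and at `0`; the roots are roots of unity, so nothing vanishes).
-/

set_option linter.dupNamespace false

noncomputable section

open scoped NumberField
open Polynomial Complex Filter IsDedekindDomain
open Literature.NumberTheory.NumberFields Literature.NumberTheory.Automorphic
open Literature.NumberTheory.GaloisRepresentations

namespace Summit.Langlands.Langlands.Theorems.DedekindQuotientEntire

/-- **Two evaluations, generic form.**  Over a field `F`: if `∏_{a ∈ β} (X - a⁻¹) = ∏_{f ∈ fs} (X^f - 1)`
with every `f ∈ fs` non-zero, then `∏_{a ∈ β} (1 - a y) = ∏_{f ∈ fs} (1 - y^f)` for every `y`.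
Evaluating at `0` gives `∏ (-a⁻¹) = (-1)^{|fs|}` (so every `a ≠ 0`), evaluating at `y` gives
`∏ (y - a⁻¹) = ∏ (y^f - 1)`, and `1 - a y = (-a)(y - a⁻¹)`. -/
private theorem satakeFactor_local {F : Type*} [Field F] (β : Multiset F) (fs : Multiset ℕ)
    (hfs : ∀ f ∈ fs, f ≠ 0)
    (h : (β.map fun a => X - C a⁻¹).prod = (fs.map fun f => (X ^ f - 1 : F[X])).prod) (y : F) :
    (β.map fun a => 1 - a * y).prod = (fs.map fun f => 1 - y ^ f).prod := by
  -- evaluation at `0`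
  have h0 : (β.map fun a => -a⁻¹).prod = (-1) ^ Multiset.card fs := by
    have e := congrArg (eval 0) h
    simp only [eval_multiset_prod, Multiset.map_map, Function.comp_def, eval_sub, eval_X, eval_C,
      eval_pow, eval_one, zero_sub] at e
    rw [e, ← Multiset.prod_replicate, ← Multiset.map_const']
    exact congrArg _ (Multiset.map_congr rfl fun f hf => by rw [zero_pow (hfs f hf), zero_sub])
  -- hence no `a ∈ β` vanishes
  have hne : ∀ a ∈ β, a ≠ 0 := by
    intro a ha ha0
    have hz : (β.map fun a => -a⁻¹).prod = 0 :=
      Multiset.prod_eq_zero (Multiset.mem_map.mpr ⟨a, ha, by rw [ha0, inv_zero, neg_zero]⟩)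
    exact pow_ne_zero _ (neg_ne_zero.mpr (one_ne_zero' F)) (h0.symm.trans hz)
  -- evaluation at `y`
  have hy : (β.map fun a => y - a⁻¹).prod = (fs.map fun f => y ^ f - 1).prod := by
    have e := congrArg (eval y) h
    simpa only [eval_multiset_prod, Multiset.map_map, Function.comp_def, eval_sub, eval_X, eval_C,
      eval_pow, eval_one] using e
  -- the two sides as multiples of the evaluations at `y`
  have hL : (β.map fun a => 1 - a * y).prod =
      (β.map fun a => -a).prod * (β.map fun a => y - a⁻¹).prod := by
    rw [← Multiset.prod_map_mul]
    refine congrArg _ (Multiset.map_congr rfl fun a ha => ?_)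
    rw [neg_mul, mul_sub, mul_inv_cancel₀ (hne a ha)]
    ring
  have hR : (fs.map fun f => 1 - y ^ f).prod =
      (-1) ^ Multiset.card fs * (fs.map fun f => y ^ f - 1).prod := by
    rw [← Multiset.prod_replicate, ← Multiset.map_const', ← Multiset.prod_map_mul]
    exact congrArg _ (Multiset.map_congr rfl fun f _ => by ring)
  have hU : (β.map fun a => -a⁻¹).prod * (β.map fun a => -a).prod = 1 := by
    rw [← Multiset.prod_map_mul]
    calc (β.map fun a => -a⁻¹ * -a).prod = (β.map fun _ => (1 : F)).prod :=
          congrArg _ (Multiset.map_congr rfl fun a ha => by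
            rw [neg_mul_neg, inv_mul_cancel₀ (hne a ha)])
      _ = 1 := by rw [Multiset.map_const', Multiset.prod_replicate, one_pow]
  have hV : ((-1 : F) ^ Multiset.card fs) * (-1) ^ Multiset.card fs = 1 := by
    rw [← mul_pow, neg_mul_neg, one_mul, one_pow]
  rw [hL, hR]
  linear_combination (β.map fun a => -a).prod * hy
    - (fs.map fun f => y ^ f - 1).prod * (β.map fun a => -a).prod * (-1) ^ Multiset.card fs * h0
    + (fs.map fun f => y ^ f - 1).prod * (-1) ^ Multiset.card fs * hU
    - (fs.map fun f => y ^ f - 1).prod * (β.map fun a => -a).prod * hV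

/-- The Dedekind polynomial of `K` at `q` as a product over the splitting type:
`∏_{𝔭 ∣ q} (X^{f(𝔭|q)} - 1) = ∏_{f ∈ splittingType K q} (X^f - 1)` (any coefficient ring). -/
private theorem satakeFactor_dedekindPoly (R : Type*) [CommRing R] (K : Type) [Field K]
    [NumberField K] (q : ℕ) :
    (∏ 𝔭 ∈ (UniqueFactorizationMonoid.factors (Ideal.span {((q : ℕ) : 𝓞 K)})).toFinset,
        (X ^ (𝔭.inertiaDeg ℤ) - 1 : R[X])) =
      ((splittingType K q).map fun f => (X ^ f - 1 : R[X])).prod := by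
  rw [splittingType_def, Finset.prod_eq_multiset_prod, Multiset.toFinset_val,
    UniqueFactorizationMonoid.factors_eq_normalizedFactors, Multiset.map_map]
  rfl

/-- **Two evaluations** (stub A of crux `DedekindQuotientEntire`): if `(X - 1)·∏_{a ∈ α} (X - ι⁻¹(a⁻¹))`
(the predicted characteristic polynomial of arithmetic Frobenius `arithFrobPolyOfSatake ι q 1 α`
times `X - 1`) is the Dedekind polynomial `∏_{𝔭 ∣ q} (X^{f(𝔭|q)} - 1)` of `K` at the prime `q`,
then for every `y : ℂ`, `(1 - y)·∏_{a∈α}(1 - a y) = ∏_{f ∈ splittingType K q} (1 - y^f)`: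
push the identity to `ℂ[X]` along `ι` and evaluate at `y` and at `0`. -/
theorem stub_satakeFactor_eq_splittingType {ℓ : ℕ} [Fact ℓ.Prime] (ι : PadicAlgCl ℓ ≃+* ℂ)
    (K : Type) [Field K] [NumberField K] {q : ℕ} (hq : q.Prime) (α : Multiset ℂ)
    (h : (X - C 1) * arithFrobPolyOfSatake ι q 1 α =
      (∏ 𝔭 ∈ (UniqueFactorizationMonoid.factors (Ideal.span {((q : ℕ) : 𝓞 K)})).toFinset,
        (X ^ (𝔭.inertiaDeg ℤ) - 1 : ℤ[X])).map (Int.castRingHom (PadicAlgCl ℓ)))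
    (y : ℂ) :
    (1 - y) * (α.map fun a => 1 - a * y).prod =
      ((splittingType K q).map fun f => 1 - y ^ f).prod := by
  -- the identity in `ℂ[X]`
  have hC : ((1 ::ₘ α).map fun a => X - C a⁻¹).prod =
      ((splittingType K q).map fun f => (X ^ f - 1 : ℂ[X])).prod := by
    have e := congrArg (Polynomial.map (ι : PadicAlgCl ℓ →+* ℂ)) h
    rw [Polynomial.map_map, RingHom.ext_int (RingHom.comp _ (Int.castRingHom _)) (Int.castRingHom ℂ),
      Polynomial.map_mul, arithFrobPolyOfSatake_one, Polynomial.map_multiset_prod, Multiset.map_map,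
      Polynomial.map_prod] at e
    simp only [Function.comp_def, Polynomial.map_sub, Polynomial.map_X, Polynomial.map_C,
      Polynomial.map_pow, Polynomial.map_one, RingHom.coe_coe, RingEquiv.apply_symm_apply,
      map_one] at e
    rw [← satakeFactor_dedekindPoly ℂ K q, Multiset.map_cons, Multiset.prod_cons, inv_one, map_one]
    exact e
  have key := satakeFactor_local (1 ::ₘ α) (splittingType K q)
    (fun f hf => (splittingType_pos hq hf).ne') hC y
  rwa [Multiset.map_cons, Multiset.prod_cons, one_mul] at key

end Summit.Langlands.Langlands.Theorems.DedekindQuotientEntire
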